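import Summits.BirchSwinnertonDyer.BirchSwinnertonDyer.Theorems.PrintCFramBottomClassIndexLawFiveLeCuspSeedCutSummability
import HarnessLib

set_option autoImplicit false

/-!
# Crux `PrintCFram.BottomClassIndexLawFiveLe` (stmt-BirchSwinnertonDyer-20372), line `eisenstein-resource-bdp-line` (registry v24/v25):
# (E3) OF THE CUSP-CONJUNCT ASSEMBLY, ANALYTIC PART 3 — FUBINI: THE CUT SERIES AS ONE `(a, b)` SUM AGAINST THE FAMILY `L`-SERIES
# (cell `bsd-print-cfram`, width seat `bsd-line-cfram-p1-w5` g6; THEOREMS ONLY, `--supports` 20372; BSD is not proved by any of this)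

HONEST FRAMING. `tsum` bookkeeping; nothing modular. For `Re s > k + 1/2` (absolute convergence everywhere, part 2) the unfolded cut series
is rearranged so that the squarefree variable `N` is summed FIRST, against w3 g13's family weight `W_n(N) = 𝟙_F(N)·J(n|N)`
(`FamilyMean.tendsto_sub_one_mul_LSeries_family`, p696224):

* `tsum_tsum_comm_of_norm_le` — abstract Fubini on `ℕ × (ℕ × ℕ)` under product majorants; `tsum_familyWeight_cpow_eq_LSeries`;
* `tsum_family_mul_tsum_eq_tsum_mul_LSeries` — `Σ_N 𝟙_F(N)N^{−τ}Σ_{(a,b)}T_s(a,b)J(ab|N) = Σ_{(a,b)}T_s(a,b)·L(W_{ab},τ)`, `τ = s − k + 1/2`;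
* **`LSeries_ite_cut_cohenH_eq_mul_tsum`** — `Σ_{a∈CUT}H(k,a)a^{−s} = [c_k π^{−k}L(𝟙_{⊥6m},2s)L(𝟙_{⊥6m}id^{2k−1},2s)]·m^{−τ}·
  Σ_{(a,b)} χ_e(a)a^{−k}·𝟙_{b⊥6m}μ(b)χ_e(b)b^{−(2s−k+1)}·L(W_{ab},τ)` (crux notes `Lines/eisenstein-resource-bdp-line-w5g5-cusp-seed.md` §5,
  with `L(k,χ)/L^{(M)}(k+2σ,χ)` expanded as the `(a,b)` sum).

[folklore] beyond Cohen's numbers. References: [Cohen1975] §2.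
-/

-- summit-side namespace `Summit.BirchSwinnertonDyer.BirchSwinnertonDyer.…` (single-conjunct summit, D-0017 layout)
set_option linter.dupNamespace false

namespace Summit.BirchSwinnertonDyer.BirchSwinnertonDyer.Theorems.PrintCFram.CuspSeed

open LSeries ArithmeticFunction Literature.NumberTheory.ModularForms.CohenEisenstein
  Literature.NumberTheory.QuadraticFields
open scoped LSeries.notation ArithmeticFunction.Moebius NumberTheorySymbols Classical

/-! ## §B2 Fubini: the family sum inside the `(a, b)` sum -/

/-- Norm of a term with a bounded coefficient: `‖term f s n‖ ≤ ‖term 1 s n‖` when `‖f n‖ ≤ 1`. [folklore] -/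
theorem norm_term_le_norm_term_one {f : ℕ → ℂ} (hf : ∀ n, ‖f n‖ ≤ 1) (s : ℂ) (n : ℕ) :
    ‖term f s n‖ ≤ ‖term (fun _ : ℕ ↦ (1 : ℂ)) s n‖ :=
  norm_term_le s (by simpa using hf n)

/-- `‖χ_e(a)‖ ≤ 1`. [folklore] -/
theorem norm_chiDisc_le_one (e : ℤ) (a : ℕ) : ‖(chiDisc e a : ℂ)‖ ≤ 1 := by
  rcases chiDisc_trichotomy e a with h | h | h <;> rw [h] <;> simp

/-- `‖𝟙_{b⊥M} μ(b) χ_e(b)‖ ≤ 1`. [folklore] -/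
theorem norm_ite_moebius_chiDisc_le_one (e : ℤ) (M b : ℕ) :
    ‖(if b.Coprime M then (μ b : ℂ) * (chiDisc e b : ℂ) else 0)‖ ≤ 1 := by
  split_ifs
  · rw [norm_mul, Complex.norm_intCast, Complex.norm_intCast]
    have h1 : |(μ b : ℝ)| ≤ 1 := by exact_mod_cast abs_moebius_le_one
    have h2 : |(chiDisc e b : ℝ)| ≤ 1 := by rcases chiDisc_trichotomy e b with h | h | h <;> rw [h] <;> simp
    calc |(μ b : ℝ)| * |(chiDisc e b : ℝ)| ≤ 1 * 1 := by gcongr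
      _ = 1 := by ring
  · simp

/-- `‖J(n | N)‖ ≤ 1` in `ℂ`. [folklore] -/
theorem norm_jacobiSym_le_one (n : ℤ) (N : ℕ) : ‖(J(n | N) : ℂ)‖ ≤ 1 := by
  rcases jacobiSym.trichotomy n N with h | h | h <;> rw [h] <;> simp

/-- `Σ_n ‖n^{−s}‖ < ∞` for `Re s > 1`. [folklore] -/
theorem summable_norm_term_one {s : ℂ} (hs : 1 < s.re) : Summable fun n : ℕ ↦ ‖term (fun _ : ℕ ↦ (1 : ℂ)) s n‖ :=
  (LSeriesSummable_of_le_const_mul_rpow hs ⟨1, fun n _ ↦ by simp⟩).norm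

/-- **Abstract Fubini step.** If `‖W n N‖ ≤ B N` and `‖T x‖ ≤ B' x` with `B, B'` summable and nonnegative, then
`Σ_N Σ_x W(x₁x₂, N) T(x) = Σ_x T(x) Σ_N W(x₁x₂, N)`. [folklore] -/
theorem tsum_tsum_comm_of_norm_le (W : ℕ → ℕ → ℂ) (T : ℕ × ℕ → ℂ) {B : ℕ → ℝ} {B' : ℕ × ℕ → ℝ} (hB : Summable B)
    (hB' : Summable B') (hBnn : ∀ N, 0 ≤ B N) (hB'nn : ∀ x, 0 ≤ B' x) (hW : ∀ n N, ‖W n N‖ ≤ B N)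
    (hT : ∀ x, ‖T x‖ ≤ B' x) :
    ∑' N : ℕ, ∑' x : ℕ × ℕ, W (x.1 * x.2) N * T x = ∑' x : ℕ × ℕ, T x * ∑' N : ℕ, W (x.1 * x.2) N := by
  have hΦ : Summable (Function.uncurry fun (N : ℕ) (x : ℕ × ℕ) ↦ W (x.1 * x.2) N * T x) := by
    refine Summable.of_norm_bounded (Summable.mul_of_nonneg hB hB' hBnn hB'nn) fun y ↦ ?_
    obtain ⟨N, x⟩ := y
    rw [Function.uncurry_apply_pair, norm_mul]
    exact mul_le_mul (hW _ _) (hT _) (norm_nonneg _) (hBnn _)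
  have h2 := hΦ.tsum_comm
  rw [← h2]
  refine tsum_congr fun x ↦ ?_
  rw [← tsum_mul_left]
  exact tsum_congr fun N ↦ mul_comm _ _

/-- The family weight with `N^{−τ}`: its sum over `N` is w3 g13's `L(W_n, τ)`. [folklore] -/
theorem tsum_familyWeight_cpow_eq_LSeries (m n : ℕ) (τ : ℂ) :
    ∑' N : ℕ, (if Squarefree N ∧ N % 4 = 3 ∧ (2 ∣ m → N % 8 = 7) ∧
        (∀ q : ℕ, q.Prime → q ∣ m → q ≠ 2 → J(-(N : ℤ) | q) = 1) ∧ ¬ 3 ∣ N then (N : ℂ) ^ (-τ) * (J((n : ℤ) | N) : ℂ) else 0) =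
      LSeries (fun N : ℕ ↦ if Squarefree N ∧ N % 4 = 3 ∧ (2 ∣ m → N % 8 = 7) ∧
        (∀ q : ℕ, q.Prime → q ∣ m → q ≠ 2 → J(-(N : ℤ) | q) = 1) ∧ ¬ 3 ∣ N then (J((n : ℤ) | N) : ℂ) else 0) τ := by
  refine tsum_congr fun N ↦ ?_
  rcases eq_or_ne N 0 with rfl | hN0
  · rw [term_zero, if_neg]
    rintro ⟨h, -⟩
    exact absurd h (by simp)
  · rw [term_of_ne_zero hN0]
    split_ifs with hN
    · rw [Complex.cpow_neg]
      field_simp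
    · simp

/-- Norm bound for the weighted family term: `‖𝟙_F(N) N^{−τ} J(n|N)‖ ≤ ‖N^{−τ}‖`. [folklore] -/
theorem norm_familyWeight_cpow_le (m n N : ℕ) (τ : ℂ) :
    ‖(if Squarefree N ∧ N % 4 = 3 ∧ (2 ∣ m → N % 8 = 7) ∧
        (∀ q : ℕ, q.Prime → q ∣ m → q ≠ 2 → J(-(N : ℤ) | q) = 1) ∧ ¬ 3 ∣ N then (N : ℂ) ^ (-τ) * (J((n : ℤ) | N) : ℂ) else 0)‖ ≤
      ‖term (fun _ : ℕ ↦ (1 : ℂ)) τ N‖ := by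
  split_ifs with hN
  · have hN0 : N ≠ 0 := hN.1.ne_zero
    rw [term_of_ne_zero hN0, norm_mul, norm_div, norm_one, Complex.cpow_neg, norm_inv, one_div]
    exact mul_le_of_le_one_right (by positivity) (norm_jacobiSym_le_one _ _)
  · rw [norm_zero]; exact norm_nonneg _

/-- **Fubini for the family sum.** For `k ≥ 2` and `Re s > k + 1/2` (so `Re τ > 1`, `τ = s − k + 1/2`):
`Σ_N 𝟙_F(N) N^{−τ} Σ_{(a,b)} T_s(a,b) J(ab|N) = Σ_{(a,b)} T_s(a,b) · L(W_{ab}, τ)` with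
`T_s(a,b) = χ_e(a)a^{−k} · 𝟙_{b⊥6m}μ(b)χ_e(b) b^{−(2s−k+1)}`, `W_n(N) = 𝟙_F(N) J(n|N)` (w3 g13's family weight). [folklore] -/
theorem tsum_family_mul_tsum_eq_tsum_mul_LSeries (e : ℤ) (m : ℕ) {k : ℕ} (hk : 2 ≤ k) {s : ℂ}
    (hs : (k : ℝ) + 1 / 2 < s.re) :
    ∑' N : ℕ, (if Squarefree N ∧ N % 4 = 3 ∧ (2 ∣ m → N % 8 = 7) ∧
          (∀ q : ℕ, q.Prime → q ∣ m → q ≠ 2 → J(-(N : ℤ) | q) = 1) ∧ ¬ 3 ∣ N then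
        (N : ℂ) ^ (-(s - k + 1 / 2)) * ∑' x : ℕ × ℕ, term (fun a : ℕ ↦ (chiDisc e a : ℂ)) k x.1 *
          term (fun b : ℕ ↦ if b.Coprime (6 * m) then (μ b : ℂ) * (chiDisc e b : ℂ) else 0) (2 * s - k + 1) x.2 *
          (J(((x.1 * x.2 : ℕ) : ℤ) | N) : ℂ) else 0) =
      ∑' x : ℕ × ℕ, term (fun a : ℕ ↦ (chiDisc e a : ℂ)) k x.1 *
        term (fun b : ℕ ↦ if b.Coprime (6 * m) then (μ b : ℂ) * (chiDisc e b : ℂ) else 0) (2 * s - k + 1) x.2 *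
        LSeries (fun N : ℕ ↦ if Squarefree N ∧ N % 4 = 3 ∧ (2 ∣ m → N % 8 = 7) ∧
          (∀ q : ℕ, q.Prime → q ∣ m → q ≠ 2 → J(-(N : ℤ) | q) = 1) ∧ ¬ 3 ∣ N then (J(((x.1 * x.2 : ℕ) : ℤ) | N) : ℂ) else 0)
          (s - k + 1 / 2) := by
  have hτ1 : 1 < (s - k + 1 / 2 : ℂ).re := by
    simp only [Complex.sub_re, Complex.add_re, Complex.natCast_re, Complex.div_ofNat_re, Complex.one_re]; linarith
  have hk1 : 1 < (k : ℂ).re := by simp only [Complex.natCast_re]; exact_mod_cast hk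
  have hu1 : 1 < (2 * s - k + 1 : ℂ).re := by
    simp only [Complex.sub_re, Complex.add_re, Complex.mul_re, Complex.re_ofNat, Complex.im_ofNat, Complex.natCast_re,
      Complex.one_re, zero_mul, sub_zero]
    have : (2 : ℝ) ≤ k := by exact_mod_cast hk
    linarith
  have key := tsum_tsum_comm_of_norm_le
    (fun n N ↦ if Squarefree N ∧ N % 4 = 3 ∧ (2 ∣ m → N % 8 = 7) ∧
        (∀ q : ℕ, q.Prime → q ∣ m → q ≠ 2 → J(-(N : ℤ) | q) = 1) ∧ ¬ 3 ∣ N then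
        (N : ℂ) ^ (-(s - k + 1 / 2)) * (J((n : ℤ) | N) : ℂ) else 0)
    (fun x : ℕ × ℕ ↦ term (fun a : ℕ ↦ (chiDisc e a : ℂ)) k x.1 *
      term (fun b : ℕ ↦ if b.Coprime (6 * m) then (μ b : ℂ) * (chiDisc e b : ℂ) else 0) (2 * s - k + 1) x.2)
    (summable_norm_term_one hτ1)
    (Summable.mul_of_nonneg (summable_norm_term_one hk1) (summable_norm_term_one hu1) (fun _ ↦ norm_nonneg _)
      (fun _ ↦ norm_nonneg _))
    (fun _ ↦ norm_nonneg _) (fun _ ↦ mul_nonneg (norm_nonneg _) (norm_nonneg _))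
    (fun n N ↦ norm_familyWeight_cpow_le m n N _)
    (fun x ↦ by
      rw [norm_mul]
      exact mul_le_mul (norm_term_le_norm_term_one (norm_chiDisc_le_one e) _ _)
        (norm_term_le_norm_term_one (norm_ite_moebius_chiDisc_le_one e (6 * m)) _ _) (norm_nonneg _) (norm_nonneg _))
  simp_rw [tsum_familyWeight_cpow_eq_LSeries] at key
  rw [← key]
  refine tsum_congr fun N ↦ ?_
  split_ifs with hN
  · rw [← tsum_mul_left]
    refine tsum_congr fun x ↦ ?_
    ring
  · simp


/-! ## §B3 The cut `L`-series as a single `(a, b)` sum against the family `L`-series -/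

/-- **THE UNFOLDED–REFOLDED CUT SERIES.** For `e` a fundamental discriminant or `1` (`m = |e|`), parity
`(−1)^k m = −e`, `k ≥ 2`, `Re s > k + 1/2` and `τ = s − k + 1/2`:
`Σ_{a ∈ CUT} H(k,a) a^{−s} = [c_k π^{−k} L(𝟙_{⊥6m},2s) L(𝟙_{⊥6m}id^{2k−1},2s)] · m^{−τ} ·
   Σ_{(a,b)} χ_e(a)a^{−k} · 𝟙_{b⊥6m}μ(b)χ_e(b) b^{−(2s−k+1)} · L(W_{ab}, τ)`,
`W_n(N) = 𝟙_F(N)·J(n|N)` w3 g13's family weight ((E2) unfolding + the `N`-th summand + Fubini).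
[cite: Cohen1975, §2 (definition of h(r,N) and of H(r,N))] -/
theorem LSeries_ite_cut_cohenH_eq_mul_tsum {e : ℤ}
    (he : e = 1 ∨ (e % 4 = 1 ∧ Squarefree e ∧ e ≠ 1) ∨ (4 ∣ e ∧ (e / 4 % 4 = 2 ∨ e / 4 % 4 = 3) ∧ Squarefree (e / 4)))
    {m : ℕ} (hme : e.natAbs = m) {k : ℕ} (hk : 2 ≤ k) (hsign : (-1 : ℤ) ^ k * m = -e) {s : ℂ} (hs : (k : ℝ) + 1 / 2 < s.re) :
    LSeries (fun a : ℕ ↦ if m ∣ a ∧ a / m % 4 = 3 ∧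
        (∀ q : ℕ, q.Prime → q ∣ m → q ≠ 2 → J(-((a / m : ℕ) : ℤ) | q) = 1) ∧ (2 ∣ m → a / m % 8 = 7) ∧ ¬ 3 ∣ a / m
        then (cohenH k a : ℂ) else 0) s =
      ((-1 : ℂ) ^ (k / 2) * ((k - 1).factorial : ℂ) / 2 ^ (k - 1) / (Real.pi : ℂ) ^ k *
          (LSeries (fun a : ℕ ↦ if a.Coprime (6 * m) then (1 : ℂ) else 0) (2 * s) *
            LSeries (fun b : ℕ ↦ if b.Coprime (6 * m) then (b : ℂ) ^ (2 * k - 1) else 0) (2 * s))) *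
        (m : ℂ) ^ (-(s - k + 1 / 2)) *
        ∑' x : ℕ × ℕ, term (fun a : ℕ ↦ (chiDisc e a : ℂ)) k x.1 *
          term (fun b : ℕ ↦ if b.Coprime (6 * m) then (μ b : ℂ) * (chiDisc e b : ℂ) else 0) (2 * s - k + 1) x.2 *
          LSeries (fun N : ℕ ↦ if Squarefree N ∧ N % 4 = 3 ∧ (2 ∣ m → N % 8 = 7) ∧
            (∀ q : ℕ, q.Prime → q ∣ m → q ≠ 2 → J(-(N : ℤ) | q) = 1) ∧ ¬ 3 ∣ N then (J(((x.1 * x.2 : ℕ) : ℤ) | N) : ℂ) else 0)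
            (s - k + 1 / 2) := by
  have he0 : e ≠ 0 := by
    rintro rfl
    rcases he with h | ⟨h, -, -⟩ | ⟨-, h, -⟩ <;> norm_num at h
  have hm : m ≠ 0 := by rw [← hme]; exact Int.natAbs_ne_zero.mpr he0
  have hsk : (k : ℝ) < s.re := by linarith
  rw [LSeries_ite_cut_cohenH_eq he hme hm hsign (LSeriesSummable_ite_cut_cohenH he hme hk hsign hs),
    ← tsum_family_mul_tsum_eq_tsum_mul_LSeries e m hk hs, ← tsum_mul_left]
  refine tsum_congr fun N ↦ ?_
  split_ifs with hN
  · rw [lValueDisc_mul_cpow_mul_LSeries_cohenT_eq he hme hk hsign hN.1 hN.2.1 hN.2.2.2.1 hsk,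
      Complex.natCast_mul_natCast_cpow]
    ring
  · rw [mul_zero]


end Summit.BirchSwinnertonDyer.BirchSwinnertonDyer.Theorems.PrintCFram.CuspSeed
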